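import Mathlib
import Summits.PneNP.PneNP.Theorems.SfmBlNumerics

/-!
# Numerical constants of the sign-degree-2 engine, SYMBOLIC in the legs-per-output `ℓ` — line «sfm-bl»
# made parametric (cell pnp-ideate, ROUND-18 item K1'' `SignDeg2Signing.SignDeg2SigningFP`, stage S2)

FRONTIER (range avoidance for sign-degree-≤2 local maps at linear stretch; restricted-model algorithmic
rung); nothing here bears on P vs NP.

The CAND engine (`SfmBlNumerics`) fixes `L = 2^60`, `γ′ = √(6000·2^60)`, `γ_sp = 60γ′` and closes every
inequality with `norm_num`.  For sign-degree-≤2 tables the target is a `1/W` fraction of the trivial bound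
(`W = uniformW k 2`, a NON-explicit integer), so the constants must be FUNCTIONS of `ℓ = 2W` and every
inequality must hold for all `ℓ`.  Choices (all thresholds have INTEGER squares, for the machine):

* size exponent `t`, `s = 2t`, degree cap `L = 2^s = 4^t` (so `√L = 2^t`);
* Hoeffding scale `γ′ = √(102·L·s)` (`144·L·ln L ≤ γ′²` since `144·ln 2 ≤ 102`: `gamma'_sq_ge`);
* BAD threshold `γ_b = √(34·ℓ·L·s)` (`γ′²·ℓ ≤ 3γ_b²`: `gamma'_sq_mul_ell`);
* density factor `K = 4ℓ`, extraction / remainder-sparseness threshold `γ_R = 4ℓ·γ_b` (`γ_R² = 544ℓ³Ls`);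
  the conditions of `Sd2Bl.sum_trace_pow_le_legs_ell`: `γ′ℓ ≤ 3γ_R` (`gamma'_ell_le`) always, and
  `3γ_R ≤ ℓL` if `4896·ℓ·s ≤ L` (`three_gammaR_le`);
* the integer RADIUS `R = 2400·ℓ²·s·(s+1)·2^t ≥ (ℓ/3)·ρ`, `ρ = 100γ_sp(log₂(L/γ_sp)+1)`, `γ_sp = 3γ_R/ℓ`
  (`ell_rho_le_R`);
* the stretch `C = 48·R`; the remainder budget `N·√2R/2 ≤ m/4` when `N ≤ 8n + 2ℓm/L`, `12ℓR ≤ L`, `48Rn ≤ m`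
  (`remainder_budget_le_ell`);
* ONE sufficient size condition `(T1) 28800·ℓ³·s·(s+1) ≤ 2^t`, which holds for `t = 32 + 8ℓ` (`size_condition_T1`) and
  implies `12ℓR ≤ L` (`twelve_ell_R_le`) and `4896ℓs ≤ L` (`cond4896_of_T1`).
-/

set_option linter.dupNamespace false -- `Summit.PneNP.PneNP.…`: summit = sub-problem name (D-0017 single-conjunct layout)

namespace Summit.PneNP.PneNP.Theorems.Sd2Bl

open Finset BigOperators

/-! ### Logarithms and the Hoeffding scale -/

/-- `144·ln 2 ≤ 102`. -/
theorem log_two_bound : 144 * Real.log 2 ≤ 102 := by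
  have := Real.log_two_lt_d9
  linarith

/-- `2 ≤ 4^t` for `t ≥ 1`. -/
theorem two_le_L {t : ℕ} (ht : 1 ≤ t) : (2 : ℝ) ≤ (2 : ℝ) ^ (2 * t) := by
  calc (2 : ℝ) = 2 ^ 1 := by norm_num
    _ ≤ 2 ^ (2 * t) := pow_le_pow_right₀ (by norm_num) (by omega)

/-- `√L = 2^t` for `L = 4^t`. -/
theorem sqrt_L (t : ℕ) : Real.sqrt ((2 : ℝ) ^ (2 * t)) = (2 : ℝ) ^ t := by
  rw [show (2 : ℝ) ^ (2 * t) = ((2 : ℝ) ^ t) ^ 2 by rw [← pow_mul, mul_comm], Real.sqrt_sq (by positivity)]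

/-- The Hoeffding scale: `144·L·ln L ≤ γ′²` for `γ′ = √(102·L·s)`, `L = 2^s`. -/
theorem gamma'_sq_ge (s : ℕ) :
    144 * (2 : ℝ) ^ s * Real.log ((2 : ℝ) ^ s) ≤ (Real.sqrt (102 * (2 : ℝ) ^ s * s)) ^ 2 := by
  rw [Real.sq_sqrt (by positivity), Real.log_pow]
  have h := log_two_bound
  have h2 : (0 : ℝ) ≤ 2 ^ s * s := by positivity
  nlinarith

/-- `γ′²·ℓ ≤ 3·γ_b²` (in fact equality) for `γ′ = √(102·L·s)`, `γ_b = √(34·ℓ·L·s)`. -/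
theorem gamma'_sq_mul_ell (ℓ s : ℕ) :
    (Real.sqrt (102 * (2 : ℝ) ^ s * s)) ^ 2 * ℓ ≤ 3 * (Real.sqrt (34 * ℓ * (2 : ℝ) ^ s * s)) ^ 2 := by
  rw [Real.sq_sqrt (by positivity), Real.sq_sqrt (by positivity)]
  linarith

/-! ### The extraction threshold `γ_R = 4ℓ·γ_b` and `γ_sp = 3γ_R/ℓ = 12γ_b` -/

/-- `γ′·ℓ ≤ 3·γ_R`, for every `ℓ ≥ 1`. -/
theorem gamma'_ell_le (ℓ s : ℕ) (hℓ : 1 ≤ ℓ) :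
    Real.sqrt (102 * (2 : ℝ) ^ s * s) * ℓ ≤ 3 * (4 * ℓ * Real.sqrt (34 * ℓ * (2 : ℝ) ^ s * s)) := by
  have hℓ' : (1 : ℝ) ≤ ℓ := by exact_mod_cast hℓ
  have h0 : (0 : ℝ) ≤ 2 ^ s * s := by positivity
  have hsq : (Real.sqrt (102 * (2 : ℝ) ^ s * s) * ℓ) ^ 2
      ≤ (3 * (4 * ℓ * Real.sqrt (34 * ℓ * (2 : ℝ) ^ s * s))) ^ 2 := by
    rw [mul_pow, Real.sq_sqrt (by positivity)]
    rw [show (3 * (4 * (ℓ : ℝ) * Real.sqrt (34 * ℓ * (2 : ℝ) ^ s * s))) ^ 2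
        = 144 * ℓ ^ 2 * (Real.sqrt (34 * ℓ * (2 : ℝ) ^ s * s)) ^ 2 by ring, Real.sq_sqrt (by positivity)]
    have hX : (0 : ℝ) ≤ (ℓ : ℝ) ^ 2 * ((2 : ℝ) ^ s * s) := by positivity
    have h4896 : (102 : ℝ) ≤ 4896 * ℓ := by linarith
    calc (102 : ℝ) * 2 ^ s * s * ℓ ^ 2 = 102 * ((ℓ : ℝ) ^ 2 * ((2 : ℝ) ^ s * s)) := by ring
      _ ≤ (4896 * ℓ) * ((ℓ : ℝ) ^ 2 * ((2 : ℝ) ^ s * s)) := mul_le_mul_of_nonneg_right h4896 hX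
      _ = 144 * ℓ ^ 2 * (34 * ℓ * (2 : ℝ) ^ s * s) := by ring
  exact (pow_le_pow_iff_left₀ (by positivity) (by positivity) (by norm_num : (2 : ℕ) ≠ 0)).1 hsq

/-- `γ_sp = 12·γ_b ≤ L` whenever `4896·ℓ·s ≤ L`. -/
theorem gammasp_le_L (ℓ s : ℕ) (h : 4896 * (ℓ : ℝ) * s ≤ (2 : ℝ) ^ s) :
    12 * Real.sqrt (34 * ℓ * (2 : ℝ) ^ s * s) ≤ (2 : ℝ) ^ s := by
  have hL : (0 : ℝ) < (2 : ℝ) ^ s := by positivity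
  have hsq : (12 * Real.sqrt (34 * ℓ * (2 : ℝ) ^ s * s)) ^ 2 ≤ ((2 : ℝ) ^ s) ^ 2 := by
    rw [mul_pow, Real.sq_sqrt (by positivity)]
    nlinarith
  exact (pow_le_pow_iff_left₀ (by positivity) hL.le (by norm_num : (2 : ℕ) ≠ 0)).1 hsq

/-- `3·γ_R ≤ ℓ·L` whenever `4896·ℓ·s ≤ L`. -/
theorem three_gammaR_le (ℓ s : ℕ) (h : 4896 * (ℓ : ℝ) * s ≤ (2 : ℝ) ^ s) :
    3 * (4 * ℓ * Real.sqrt (34 * ℓ * (2 : ℝ) ^ s * s)) ≤ ℓ * (2 : ℝ) ^ s := by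
  have hℓ' : (0 : ℝ) ≤ ℓ := Nat.cast_nonneg _
  have h12 := gammasp_le_L ℓ s h
  calc 3 * (4 * ℓ * Real.sqrt (34 * ℓ * (2 : ℝ) ^ s * s)) = ℓ * (12 * Real.sqrt (34 * ℓ * (2 : ℝ) ^ s * s)) := by
        ring
    _ ≤ ℓ * (2 : ℝ) ^ s := mul_le_mul_of_nonneg_left h12 hℓ'

/-- `γ_sp = 3γ_R/ℓ = 12·γ_b`. -/
theorem gammasp_eq (ℓ s : ℕ) (hℓ : 1 ≤ ℓ) :
    3 * (4 * ℓ * Real.sqrt (34 * ℓ * (2 : ℝ) ^ s * s)) / ℓ = 12 * Real.sqrt (34 * ℓ * (2 : ℝ) ^ s * s) := by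
  have hℓ' : (ℓ : ℝ) ≠ 0 := by exact_mod_cast (by omega : ℓ ≠ 0)
  field_simp
  ring

/-- `1 ≤ γ_sp` (for `ℓ, s ≥ 1`). -/
theorem one_le_gammasp (ℓ s : ℕ) (hℓ : 1 ≤ ℓ) (hs : 1 ≤ s) :
    (1 : ℝ) ≤ 12 * Real.sqrt (34 * ℓ * (2 : ℝ) ^ s * s) := by
  have hℓ' : (1 : ℝ) ≤ ℓ := by exact_mod_cast hℓ
  have hs' : (1 : ℝ) ≤ s := by exact_mod_cast hs
  have hL : (1 : ℝ) ≤ (2 : ℝ) ^ s := one_le_pow₀ (by norm_num)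
  have h1 : (1 : ℝ) ≤ 34 * ℓ * (2 : ℝ) ^ s * s := by
    have := mul_le_mul hℓ' hL (by norm_num) (by linarith)
    nlinarith
  have h2 : (1 : ℝ) ≤ Real.sqrt (34 * ℓ * (2 : ℝ) ^ s * s) := by
    rw [show (1 : ℝ) = Real.sqrt 1 by simp]
    exact Real.sqrt_le_sqrt h1
  linarith

/-- `γ_sp ≤ 72·ℓ·s·2^t` for `s = 2t` (`√34 ≤ 6`, `√(ℓ s) ≤ ℓ s`, `√L = 2^t`). -/
theorem gammasp_le (ℓ t : ℕ) (hℓ : 1 ≤ ℓ) (ht : 1 ≤ t) :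
    12 * Real.sqrt (34 * ℓ * (2 : ℝ) ^ (2 * t) * (2 * t : ℕ)) ≤ 72 * ℓ * (2 * t : ℕ) * (2 : ℝ) ^ t := by
  have hℓ' : (1 : ℝ) ≤ ℓ := by exact_mod_cast hℓ
  have hs' : (1 : ℝ) ≤ ((2 * t : ℕ) : ℝ) := by exact_mod_cast (by omega : 1 ≤ 2 * t)
  have hx1 : (1 : ℝ) ≤ (ℓ : ℝ) * ((2 * t : ℕ) : ℝ) := by nlinarith
  have hsq1 : Real.sqrt ((ℓ : ℝ) * ((2 * t : ℕ) : ℝ)) ≤ (ℓ : ℝ) * ((2 * t : ℕ) : ℝ) := by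
    calc Real.sqrt ((ℓ : ℝ) * ((2 * t : ℕ) : ℝ))
        ≤ Real.sqrt (((ℓ : ℝ) * ((2 * t : ℕ) : ℝ)) ^ 2) := Real.sqrt_le_sqrt (by nlinarith)
      _ = (ℓ : ℝ) * ((2 * t : ℕ) : ℝ) := Real.sqrt_sq (by positivity)
  have h34 : Real.sqrt 34 ≤ 6 := by
    rw [show (6 : ℝ) = Real.sqrt (6 ^ 2) by rw [Real.sqrt_sq (by norm_num)]]
    exact Real.sqrt_le_sqrt (by norm_num)
  have hsplit : Real.sqrt (34 * ℓ * (2 : ℝ) ^ (2 * t) * (2 * t : ℕ))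
      = Real.sqrt 34 * Real.sqrt ((ℓ : ℝ) * ((2 * t : ℕ) : ℝ)) * (2 : ℝ) ^ t := by
    rw [show (34 : ℝ) * ℓ * (2 : ℝ) ^ (2 * t) * (2 * t : ℕ)
        = (34 * ((ℓ : ℝ) * ((2 * t : ℕ) : ℝ))) * (2 : ℝ) ^ (2 * t) by ring]
    rw [Real.sqrt_mul (by positivity), Real.sqrt_mul (by norm_num), sqrt_L]
  rw [hsplit]
  have hA : Real.sqrt 34 * Real.sqrt ((ℓ : ℝ) * ((2 * t : ℕ) : ℝ)) ≤ 6 * ((ℓ : ℝ) * ((2 * t : ℕ) : ℝ)) :=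
    mul_le_mul h34 hsq1 (Real.sqrt_nonneg _) (by norm_num)
  have h2t : (0 : ℝ) ≤ (2 : ℝ) ^ t := by positivity
  calc 12 * (Real.sqrt 34 * Real.sqrt ((ℓ : ℝ) * ((2 * t : ℕ) : ℝ)) * (2 : ℝ) ^ t)
      = 12 * ((Real.sqrt 34 * Real.sqrt ((ℓ : ℝ) * ((2 * t : ℕ) : ℝ))) * (2 : ℝ) ^ t) := by ring
    _ ≤ 12 * ((6 * ((ℓ : ℝ) * ((2 * t : ℕ) : ℝ))) * (2 : ℝ) ^ t) :=
        mul_le_mul_of_nonneg_left (mul_le_mul_of_nonneg_right hA h2t) (by norm_num)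
    _ = 72 * ℓ * (2 * t : ℕ) * (2 : ℝ) ^ t := by ring

/-- THE RADIUS: `(ℓ/3)·ρ ≤ R` with `ρ = 100·γ_sp·(log₂(L/γ_sp) + 1)`, `γ_sp = 3γ_R/ℓ`, `L = 4^t`, `s = 2t`,
`R = 2400·ℓ²·s·(s+1)·2^t`, under `4896·ℓ·s ≤ L`. -/
theorem ell_rho_le_R (ℓ t : ℕ) (hℓ : 1 ≤ ℓ) (ht : 1 ≤ t)
    (h4896 : 4896 * (ℓ : ℝ) * (2 * t : ℕ) ≤ (2 : ℝ) ^ (2 * t)) :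
    ((ℓ : ℝ) / 3) * (100 * ((3 * (4 * ℓ * Real.sqrt (34 * ℓ * (2 : ℝ) ^ (2 * t) * (2 * t : ℕ))) / ℓ)
        * (Real.logb 2 ((2 : ℝ) ^ (2 * t)
            / (3 * (4 * ℓ * Real.sqrt (34 * ℓ * (2 : ℝ) ^ (2 * t) * (2 * t : ℕ))) / ℓ)) + 1)))
      ≤ 2400 * (ℓ : ℝ) ^ 2 * (2 * t : ℕ) * ((2 * t : ℕ) + 1) * (2 : ℝ) ^ t := by
  rw [gammasp_eq ℓ (2 * t) hℓ]
  set γsp : ℝ := 12 * Real.sqrt (34 * ℓ * (2 : ℝ) ^ (2 * t) * (2 * t : ℕ)) with hγsp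
  have hγ1 : 1 ≤ γsp := one_le_gammasp ℓ (2 * t) hℓ (by omega)
  have hγ0 : 0 < γsp := by linarith
  have hL : (0 : ℝ) < (2 : ℝ) ^ (2 * t) := by positivity
  have hγL : γsp ≤ (2 : ℝ) ^ (2 * t) := gammasp_le_L ℓ (2 * t) h4896
  -- `0 ≤ log₂(L/γ_sp) ≤ 2t`
  have hlog : Real.logb 2 ((2 : ℝ) ^ (2 * t) / γsp) ≤ (2 * t : ℕ) := by
    have h1 : (2 : ℝ) ^ (2 * t) / γsp ≤ (2 : ℝ) ^ (2 * t) := div_le_self hL.le hγ1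
    have h2 : Real.logb 2 ((2 : ℝ) ^ (2 * t) / γsp) ≤ Real.logb 2 ((2 : ℝ) ^ (2 * t)) :=
      Real.logb_le_logb_of_le (by norm_num) (div_pos hL hγ0) h1
    have h3 : Real.logb 2 ((2 : ℝ) ^ (2 * t)) = (2 * t : ℕ) := by
      rw [Real.logb_pow, Real.logb_self_eq_one (by norm_num)]; push_cast; ring
    linarith
  have hlog0 : 0 ≤ Real.logb 2 ((2 : ℝ) ^ (2 * t) / γsp) :=
    Real.logb_nonneg (by norm_num) (by rw [le_div_iff₀ hγ0, one_mul]; exact hγL)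
  have hγle : γsp ≤ 72 * ℓ * (2 * t : ℕ) * (2 : ℝ) ^ t := gammasp_le ℓ t hℓ ht
  have hℓ0 : (0 : ℝ) ≤ (ℓ : ℝ) / 3 := by positivity
  have hprod : γsp * (Real.logb 2 ((2 : ℝ) ^ (2 * t) / γsp) + 1)
      ≤ (72 * ℓ * (2 * t : ℕ) * (2 : ℝ) ^ t) * (((2 * t : ℕ) : ℝ) + 1) :=
    mul_le_mul hγle (by linarith) (by linarith) (by positivity)
  calc ((ℓ : ℝ) / 3) * (100 * (γsp * (Real.logb 2 ((2 : ℝ) ^ (2 * t) / γsp) + 1)))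
      ≤ ((ℓ : ℝ) / 3) * (100 * ((72 * ℓ * (2 * t : ℕ) * (2 : ℝ) ^ t) * (((2 * t : ℕ) : ℝ) + 1))) :=
        mul_le_mul_of_nonneg_left (mul_le_mul_of_nonneg_left hprod (by norm_num)) hℓ0
    _ = 2400 * (ℓ : ℝ) ^ 2 * (2 * t : ℕ) * ((2 * t : ℕ) + 1) * (2 : ℝ) ^ t := by ring

/-! ### The size condition `(T1)` and its consequences -/

/-- `(T1)` holds for `t = 32 + 8ℓ`: `28800·ℓ³·s·(s+1) ≤ 2^t`, `s = 2t`, for every `ℓ`. -/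
theorem size_condition_T1 (ℓ : ℕ) :
    28800 * ℓ ^ 3 * (2 * (32 + 8 * ℓ)) * (2 * (32 + 8 * ℓ) + 1) ≤ 2 ^ (32 + 8 * ℓ) := by
  rcases Nat.eq_zero_or_pos ℓ with rfl | hℓ
  · simp
  have h1 : 2 * (32 + 8 * ℓ) ≤ 80 * ℓ := by omega
  have h2 : 2 * (32 + 8 * ℓ) + 1 ≤ 81 * ℓ := by omega
  have h3 : ℓ ≤ 2 ^ ℓ := Nat.lt_two_pow_self.le
  calc 28800 * ℓ ^ 3 * (2 * (32 + 8 * ℓ)) * (2 * (32 + 8 * ℓ) + 1)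
      ≤ 28800 * ℓ ^ 3 * (80 * ℓ) * (81 * ℓ) := by gcongr
    _ = 186624000 * ℓ ^ 5 := by ring
    _ ≤ 2 ^ 28 * (2 ^ ℓ) ^ 5 := by gcongr; norm_num
    _ = 2 ^ (28 + 5 * ℓ) := by rw [← pow_mul, ← pow_add]; ring_nf
    _ ≤ 2 ^ (32 + 8 * ℓ) := Nat.pow_le_pow_right (by norm_num) (by omega)

/-- `(T1)` implies `4896·ℓ·s ≤ L` (real form). -/
theorem cond4896_of_T1 (ℓ t : ℕ) (hℓ : 1 ≤ ℓ)
    (hT1 : 28800 * ℓ ^ 3 * (2 * t) * (2 * t + 1) ≤ 2 ^ t) :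
    4896 * (ℓ : ℝ) * (2 * t : ℕ) ≤ (2 : ℝ) ^ (2 * t) := by
  have h1 : 4896 * ℓ * (2 * t) ≤ 28800 * ℓ ^ 3 * (2 * t) * (2 * t + 1) := by
    have : ℓ ≤ ℓ ^ 3 := by
      calc ℓ = ℓ ^ 1 := (pow_one ℓ).symm
        _ ≤ ℓ ^ 3 := Nat.pow_le_pow_right hℓ (by norm_num)
    calc 4896 * ℓ * (2 * t) ≤ 28800 * ℓ ^ 3 * (2 * t) := by gcongr; norm_num
      _ = 28800 * ℓ ^ 3 * (2 * t) * 1 := by ring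
      _ ≤ 28800 * ℓ ^ 3 * (2 * t) * (2 * t + 1) := by gcongr; omega
  have h2 : 2 ^ t ≤ 2 ^ (2 * t) := Nat.pow_le_pow_right (by norm_num) (by omega)
  have h3 : 4896 * ℓ * (2 * t) ≤ 2 ^ (2 * t) := h1.trans (hT1.trans h2)
  exact_mod_cast h3

/-- `(T1)` implies `12·ℓ·R ≤ L` for the radius `R = 2400·ℓ²·s·(s+1)·2^t` (real form). -/
theorem twelve_ell_R_le (ℓ t : ℕ) (hT1 : 28800 * ℓ ^ 3 * (2 * t) * (2 * t + 1) ≤ 2 ^ t) :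
    12 * (ℓ : ℝ) * (2400 * (ℓ : ℝ) ^ 2 * (2 * t : ℕ) * ((2 * t : ℕ) + 1) * (2 : ℝ) ^ t)
      ≤ (2 : ℝ) ^ (2 * t) := by
  have h1 : (28800 * ℓ ^ 3 * (2 * t) * (2 * t + 1) : ℝ) ≤ (2 : ℝ) ^ t := by exact_mod_cast hT1
  have h2 : (0 : ℝ) ≤ (2 : ℝ) ^ t := by positivity
  calc 12 * (ℓ : ℝ) * (2400 * (ℓ : ℝ) ^ 2 * (2 * t : ℕ) * ((2 * t : ℕ) + 1) * (2 : ℝ) ^ t)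
      = (28800 * ℓ ^ 3 * (2 * t) * (2 * t + 1) : ℝ) * (2 : ℝ) ^ t := by push_cast; ring
    _ ≤ (2 : ℝ) ^ t * (2 : ℝ) ^ t := mul_le_mul_of_nonneg_right h1 h2
    _ = (2 : ℝ) ^ (2 * t) := by rw [← pow_add]; ring_nf

/-! ### Budgets -/

/-- REMAINDER BUDGET (symbolic): `N·√2R/2 ≤ m/4` when `N ≤ 8n + 2ℓm/L`, `12ℓR ≤ L`, `48Rn ≤ m`, `n ≥ 1`. -/
theorem remainder_budget_le_ell {n m : ℕ} {L N R ℓ : ℝ} (hL : 0 < L) (hℓ : 0 ≤ ℓ) (hR : 0 ≤ R)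
    (hC : 48 * R * n ≤ m) (h12 : 12 * ℓ * R ≤ L) (hN : N ≤ 8 * n + 2 * ℓ * m / L) :
    N * (Real.sqrt 2 * R) / 2 ≤ (m : ℝ) / 4 := by
  have hs := SfmBl.sqrt_two_le
  have hs0 : 0 ≤ Real.sqrt 2 := Real.sqrt_nonneg 2
  have hm : (0 : ℝ) ≤ m := Nat.cast_nonneg m
  have hn0 : (0 : ℝ) ≤ n := Nat.cast_nonneg n
  -- `ℓ R m / L ≤ m / 12`
  have hfrac : ℓ * R * m / L ≤ m / 12 := by
    rw [div_le_div_iff₀ hL (by norm_num)]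
    have := mul_le_mul_of_nonneg_left h12 hm
    nlinarith
  have h1 : N * (Real.sqrt 2 * R) / 2 ≤ (8 * n + 2 * ℓ * m / L) * (Real.sqrt 2 * R) / 2 := by
    have : 0 ≤ Real.sqrt 2 * R := mul_nonneg hs0 hR
    gcongr
  have h2 : (8 * n + 2 * ℓ * m / L) * (Real.sqrt 2 * R) / 2
      = Real.sqrt 2 * (4 * (R * n) + ℓ * R * m / L) := by
    field_simp
    ring
  rw [h2] at h1
  have h3 : 4 * (R * n) + ℓ * R * m / L ≤ m / 12 + m / 12 := by
    have : R * n ≤ m / 48 := by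
      rw [le_div_iff₀ (by norm_num)]; linarith
    linarith
  have h4 : Real.sqrt 2 * (4 * (R * n) + ℓ * R * m / L) ≤ 1.4143 * (m / 12 + m / 12) := by
    have h0 : 0 ≤ 4 * (R * n) + ℓ * R * m / L := by positivity
    exact mul_le_mul hs h3 h0 (by norm_num)
  calc N * (Real.sqrt 2 * R) / 2 ≤ Real.sqrt 2 * (4 * (R * n) + ℓ * R * m / L) := h1
    _ ≤ 1.4143 * (m / 12 + m / 12) := h4
    _ ≤ (m : ℝ) / 4 := by nlinarith

/-- BAD BUDGET: `Q₀ ≤ 8ℓm·L⁻¹⁰ ≤ m/120` when `960·ℓ ≤ L^10`. -/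
theorem Q0_budget {m : ℕ} {L ℓ Q₀ : ℝ} (hL : 0 < L) (h960 : 960 * ℓ ≤ L ^ 10)
    (hQ : Q₀ ≤ 8 * ℓ * m * (L ^ 10)⁻¹) : Q₀ ≤ (m : ℝ) / 120 := by
  have hm : (0 : ℝ) ≤ m := Nat.cast_nonneg m
  have hL10 : 0 < L ^ 10 := by positivity
  refine hQ.trans ?_
  rw [← div_eq_mul_inv, div_le_div_iff₀ hL10 (by norm_num)]
  nlinarith

/-- `960·ℓ ≤ L^10` from `4896·ℓ·s ≤ L`, `s ≥ 1`, `L ≥ 1`. -/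
theorem cond960 {L ℓ s : ℝ} (hℓ : 0 ≤ ℓ) (hs : 1 ≤ s) (hL : 1 ≤ L) (h : 4896 * ℓ * s ≤ L) :
    960 * ℓ ≤ L ^ 10 := by
  have h1 : 960 * ℓ ≤ 4896 * ℓ * s := by nlinarith
  have h2 : L ≤ L ^ 10 := by
    calc L = L ^ 1 := (pow_one L).symm
      _ ≤ L ^ 10 := pow_le_pow_right₀ hL (by norm_num)
  linarith

end Summit.PneNP.PneNP.Theorems.Sd2Bl
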